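import Mathlib
import HarnessLib

/-!
# Twisted products of 'good sides': the engine behind two-copy Harris positivity on series–parallel graphs

Helper file for crux `stmt-CriticalPhenomena-4575` (new-inequality factory `prim-ineq-gen-1`, gen 16); memo
`run/shared/lean/prim/prim-ineq-gen-1/FINDING-22-series-parallel.md` §1.  Companion of the gen-15 files
`…TwoCopyTwoSum.lean`, `…TwoCopyTwoSumClosure.lean`, `…TwoCopySideClosure.lean`, `…TwoCopyEdgeBridge.lean`; used by
`…TwoCopySeriesParallel.lean` (THEOREM A of the memo).

ABSTRACT SETTING.  A *side* is a finite poset `Ω` of configurations with weights `w : Ω → R` in a partially ordered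
commutative ring and a distinguished Boolean event `c : Ω → Bool` (for a two-terminal graph `(N; x, y)`: `Ω = 2^{E(N)}`,
`w ω = y^ω q^{k(ω)}`, `c ω = [x ~ y in ω]`).  Its blocks on an up-set `V` are `P(V) = Σ_{ω ∈ V, c ω} w ω` and
`Q(V) = Σ_{ω ∈ V, ¬ c ω} w ω` (`blk w c true V`, `blk w c false V`), and the side is GOOD (`GoodSide`) when all weights are
`≥ 0` and `P(⊤)·Q(V) ≤ P(V)·Q(⊤)` for every monotone `V` — equivalently the two-copy Harris form
`H(c, V) = Z[c ∧ V]·Z[⊤] − Z[c]·Z[V] = Q(⊤)P(V) − P(⊤)Q(V)` is `≥ 0` (`harrisForm_nonneg`).  Over `R = ℤ[q, (y_e)]` with the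
coefficientwise order this is the lane's graded conjecture (H*) for the event `c` against every increasing event.

RESULT (this work, 2026-08-21): `goodSide_twist_or` / `goodSide_twist_and` — if two sides are good then so is their
TWISTED PRODUCT `Ω₁ × Ω₂` with weight `w₁ ω₁ · w₂ ω₂ · τ (c₁ ω₁) (c₂ ω₂)` for ANY nonnegative twist `τ : Bool → Bool → R`,
with the event `c₁ ∨ c₂` resp. `c₁ ∧ c₂`.  Parallel composition of two-terminal graphs is the twist
`τ a b = if a && b then q else 1` with `c₁ ∨ c₂` (`k = k₁ + k₂ − 2 + [c₁][c₂]`); series composition and 1-sums are the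
trivial twist with `c₁ ∧ c₂`.  The proof is the three-term identity of the memo (§1(c)): after expressing the glued blocks
through the section blocks `U a b V = Σ_{c₁ = a, c₂ = b, V} w₁w₂` (`secU`), the difference `P(V)Q(⊤) − P(⊤)Q(V)` is a
nonnegative combination of the hypotheses applied to the SECTIONS `V(·, ω₂)`, `V(ω₁, ·)` of the up-set
(`sec_ineq_left`, `sec_ineq_right`).  Only `τ ≥ 0` is used — the single-side event `c₁` alone would need a
log-supermodular twist, the coproduct/product events do not.
-/

namespace Summit.CriticalPhenomena.PercolationContinuityZ3.Theorems

namespace TwoCopyTwistedProduct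

open Finset

variable {R : Type*} [CommRing R] [PartialOrder R] [IsOrderedRing R]

section Blocks

variable {Ω : Type*} [Fintype Ω]

/-- The block `Σ_{ω : c ω = a, V ω} w ω` of a side: `a = true` is `P(V)` (event holds), `a = false` is `Q(V)`. [this work] -/
def blk (w : Ω → R) (c : Ω → Bool) (a : Bool) (V : Ω → Bool) : R :=
  ∑ ω, if (c ω == a) && V ω then w ω else 0

/-- The trivial up-set (everything). [this work] -/
def top : Ω → Bool := fun _ => true

/-- Blocks of a side with nonnegative weights are nonnegative. [this work] -/
theorem blk_nonneg (w : Ω → R) (c : Ω → Bool) (a : Bool) (V : Ω → Bool) (hw : ∀ ω, 0 ≤ w ω) :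
    0 ≤ blk w c a V := by
  unfold blk
  refine Finset.sum_nonneg fun ω _ => ?_
  split_ifs
  · exact hw ω
  · exact le_refl _

end Blocks

section Good

variable {Ω : Type*} [Fintype Ω] [Preorder Ω]

/-- A side is GOOD: weights are nonnegative and `P(⊤)·Q(V) ≤ P(V)·Q(⊤)` for every up-set (monotone Boolean) `V` —
the graded two-copy Harris form of the event `c` against every increasing event is nonnegative. [this work] -/
structure GoodSide (w : Ω → R) (c : Ω → Bool) : Prop where
  /-- all weights are nonnegative -/
  nonneg : ∀ ω, 0 ≤ w ω
  /-- `P(⊤)·Q(V) ≤ P(V)·Q(⊤)` for every monotone `V` -/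
  le : ∀ V : Ω → Bool, Monotone V → blk w c true top * blk w c false V ≤ blk w c true V * blk w c false top

/-- For a good side the Harris form `Z[c ∧ V]·Z[⊤] − Z[c]·Z[V]` is nonnegative for every up-set `V`. [this work] -/
theorem harrisForm_nonneg {w : Ω → R} {c : Ω → Bool} (h : GoodSide w c) (V : Ω → Bool) (hV : Monotone V) :
    0 ≤ blk w c true V * (blk w c true top + blk w c false top)
        - blk w c true top * (blk w c true V + blk w c false V) := by
  have h1 := h.le V hV
  have : blk w c true V * (blk w c true top + blk w c false top)
        - blk w c true top * (blk w c true V + blk w c false V)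
      = blk w c true V * blk w c false top - blk w c true top * blk w c false V := by ring
  rw [this]
  exact sub_nonneg.mpr h1

end Good

section Sections

variable {Ω₁ Ω₂ : Type*} [Preorder Ω₁] [Preorder Ω₂]

/-- Sections `V(·, ω₂)` of a monotone `V` on a product are monotone. [this work] -/
theorem monotone_section_left {V : Ω₁ × Ω₂ → Bool} (hV : Monotone V) (ω₂ : Ω₂) :
    Monotone fun ω₁ => V (ω₁, ω₂) :=
  fun _ _ hab => hV (Prod.mk_le_mk.mpr ⟨hab, le_rfl⟩)

/-- Sections `V(ω₁, ·)` of a monotone `V` on a product are monotone. [this work] -/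
theorem monotone_section_right {V : Ω₁ × Ω₂ → Bool} (hV : Monotone V) (ω₁ : Ω₁) :
    Monotone fun ω₂ => V (ω₁, ω₂) :=
  fun _ _ hab => hV (Prod.mk_le_mk.mpr ⟨le_rfl, hab⟩)

/-- The trivial up-set is monotone. [this work] -/
theorem monotone_top {Ω : Type*} [Preorder Ω] : Monotone (top : Ω → Bool) := fun _ _ _ => le_rfl

end Sections

section Twist

variable {Ω₁ Ω₂ : Type*} [Fintype Ω₁] [Fintype Ω₂]
variable (w₁ : Ω₁ → R) (c₁ : Ω₁ → Bool) (w₂ : Ω₂ → R) (c₂ : Ω₂ → Bool) (τ : Bool → Bool → R)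

/-- Twisted product weight `w₁ ω₁ · w₂ ω₂ · τ (c₁ ω₁) (c₂ ω₂)`. [this work] -/
def twistW : Ω₁ × Ω₂ → R := fun ω => w₁ ω.1 * w₂ ω.2 * τ (c₁ ω.1) (c₂ ω.2)

/-- The glued event `c₁ ∨ c₂` (parallel composition: terminals joined through either side). [this work] -/
def orC : Ω₁ × Ω₂ → Bool := fun ω => c₁ ω.1 || c₂ ω.2

/-- The glued event `c₁ ∧ c₂` (series composition / 1-sum). [this work] -/
def andC : Ω₁ × Ω₂ → Bool := fun ω => c₁ ω.1 && c₂ ω.2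

/-- Untwisted section blocks `U a b V = Σ_{c₁ ω₁ = a, c₂ ω₂ = b, V(ω₁,ω₂)} w₁ ω₁ · w₂ ω₂`. [this work] -/
def secU (a b : Bool) (V : Ω₁ × Ω₂ → Bool) : R :=
  ∑ ω : Ω₁ × Ω₂, if (c₁ ω.1 == a) && (c₂ ω.2 == b) && V ω then w₁ ω.1 * w₂ ω.2 else 0

omit [PartialOrder R] [IsOrderedRing R] in
/-- Pointwise form of the `Q`-block of the `∨`-glued side. [this work] -/
private theorem pt_or_false (a b v : Bool) (x : R) :
    (if ((a || b) == false) && v then x * τ a b else 0)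
      = τ false false * (if (a == false) && (b == false) && v then x else 0) := by
  cases a <;> cases b <;> cases v <;> simp [mul_comm]

omit [PartialOrder R] [IsOrderedRing R] in
/-- Pointwise form of the `P`-block of the `∨`-glued side. [this work] -/
private theorem pt_or_true (a b v : Bool) (x : R) :
    (if ((a || b) == true) && v then x * τ a b else 0)
      = τ true true * (if (a == true) && (b == true) && v then x else 0)
        + τ true false * (if (a == true) && (b == false) && v then x else 0)
        + τ false true * (if (a == false) && (b == true) && v then x else 0) := by
  cases a <;> cases b <;> cases v <;> simp [mul_comm]

omit [PartialOrder R] [IsOrderedRing R] in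
/-- Pointwise form of the `P`-block of the `∧`-glued side. [this work] -/
private theorem pt_and_true (a b v : Bool) (x : R) :
    (if ((a && b) == true) && v then x * τ a b else 0)
      = τ true true * (if (a == true) && (b == true) && v then x else 0) := by
  cases a <;> cases b <;> cases v <;> simp [mul_comm]

omit [PartialOrder R] [IsOrderedRing R] in
/-- Pointwise form of the `Q`-block of the `∧`-glued side. [this work] -/
private theorem pt_and_false (a b v : Bool) (x : R) :
    (if ((a && b) == false) && v then x * τ a b else 0)
      = τ true false * (if (a == true) && (b == false) && v then x else 0)
        + τ false true * (if (a == false) && (b == true) && v then x else 0)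
        + τ false false * (if (a == false) && (b == false) && v then x else 0) := by
  cases a <;> cases b <;> cases v <;> simp [mul_comm]

omit [PartialOrder R] [IsOrderedRing R] in
/-- `Q`-block of the `∨`-glued side: `τ₀₀ · U₀₀`. [this work] -/
theorem blk_or_false (V : Ω₁ × Ω₂ → Bool) :
    blk (twistW w₁ c₁ w₂ c₂ τ) (orC c₁ c₂) false V = τ false false * secU w₁ c₁ w₂ c₂ false false V := by
  unfold blk secU twistW orC
  rw [Finset.mul_sum]
  refine Finset.sum_congr rfl fun ω _ => ?_
  exact pt_or_false τ (c₁ ω.1) (c₂ ω.2) (V ω) (w₁ ω.1 * w₂ ω.2)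

omit [PartialOrder R] [IsOrderedRing R] in
/-- `P`-block of the `∨`-glued side: `τ₁₁U₁₁ + τ₁₀U₁₀ + τ₀₁U₀₁`. [this work] -/
theorem blk_or_true (V : Ω₁ × Ω₂ → Bool) :
    blk (twistW w₁ c₁ w₂ c₂ τ) (orC c₁ c₂) true V
      = τ true true * secU w₁ c₁ w₂ c₂ true true V + τ true false * secU w₁ c₁ w₂ c₂ true false V
        + τ false true * secU w₁ c₁ w₂ c₂ false true V := by
  unfold blk secU twistW orC
  rw [Finset.mul_sum, Finset.mul_sum, Finset.mul_sum, ← Finset.sum_add_distrib, ← Finset.sum_add_distrib]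
  refine Finset.sum_congr rfl fun ω _ => ?_
  exact pt_or_true τ (c₁ ω.1) (c₂ ω.2) (V ω) (w₁ ω.1 * w₂ ω.2)

omit [PartialOrder R] [IsOrderedRing R] in
/-- `P`-block of the `∧`-glued side: `τ₁₁ · U₁₁`. [this work] -/
theorem blk_and_true (V : Ω₁ × Ω₂ → Bool) :
    blk (twistW w₁ c₁ w₂ c₂ τ) (andC c₁ c₂) true V = τ true true * secU w₁ c₁ w₂ c₂ true true V := by
  unfold blk secU twistW andC
  rw [Finset.mul_sum]
  refine Finset.sum_congr rfl fun ω _ => ?_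
  exact pt_and_true τ (c₁ ω.1) (c₂ ω.2) (V ω) (w₁ ω.1 * w₂ ω.2)

omit [PartialOrder R] [IsOrderedRing R] in
/-- `Q`-block of the `∧`-glued side: `τ₁₀U₁₀ + τ₀₁U₀₁ + τ₀₀U₀₀`. [this work] -/
theorem blk_and_false (V : Ω₁ × Ω₂ → Bool) :
    blk (twistW w₁ c₁ w₂ c₂ τ) (andC c₁ c₂) false V
      = τ true false * secU w₁ c₁ w₂ c₂ true false V + τ false true * secU w₁ c₁ w₂ c₂ false true V
        + τ false false * secU w₁ c₁ w₂ c₂ false false V := by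
  unfold blk secU twistW andC
  rw [Finset.mul_sum, Finset.mul_sum, Finset.mul_sum, ← Finset.sum_add_distrib, ← Finset.sum_add_distrib]
  refine Finset.sum_congr rfl fun ω _ => ?_
  exact pt_and_false τ (c₁ ω.1) (c₂ ω.2) (V ω) (w₁ ω.1 * w₂ ω.2)

omit [PartialOrder R] [IsOrderedRing R] in
/-- Pointwise regrouping used for the iterated forms of the section blocks. [this work] -/
private theorem pt_sec (ca cb v : Bool) (x y : R) :
    (if ca && cb && v then x * y else 0) = if cb then y * (if ca && v then x else 0) else 0 := by
  cases ca <;> cases cb <;> cases v <;> simp [mul_comm]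

omit [PartialOrder R] [IsOrderedRing R] in
/-- Pointwise regrouping, first factor outside. [this work] -/
private theorem pt_sec' (ca cb v : Bool) (x y : R) :
    (if ca && cb && v then x * y else 0) = if ca then x * (if cb && v then y else 0) else 0 := by
  cases ca <;> cases cb <;> cases v <;> simp

omit [PartialOrder R] [IsOrderedRing R] in
/-- Section block as an iterated sum over the SECOND factor: `U a b V = Σ_{ω₂: c₂ = b} w₂ · blk₁ a (V(·,ω₂))`. [this work] -/
theorem secU_eq_sum_right (a b : Bool) (V : Ω₁ × Ω₂ → Bool) :
    secU w₁ c₁ w₂ c₂ a b V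
      = ∑ ω₂, if c₂ ω₂ == b then w₂ ω₂ * blk w₁ c₁ a (fun ω₁ => V (ω₁, ω₂)) else 0 := by
  unfold secU blk
  rw [Fintype.sum_prod_type_right]
  refine Finset.sum_congr rfl fun ω₂ _ => ?_
  rw [Finset.sum_congr rfl fun ω₁ _ => pt_sec (c₁ ω₁ == a) (c₂ ω₂ == b) (V (ω₁, ω₂)) (w₁ ω₁) (w₂ ω₂)]
  cases c₂ ω₂ == b
  · simp
  · simp only [if_true, Finset.mul_sum]

omit [PartialOrder R] [IsOrderedRing R] in
/-- Section block as an iterated sum over the FIRST factor: `U a b V = Σ_{ω₁: c₁ = a} w₁ · blk₂ b (V(ω₁,·))`. [this work] -/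
theorem secU_eq_sum_left (a b : Bool) (V : Ω₁ × Ω₂ → Bool) :
    secU w₁ c₁ w₂ c₂ a b V
      = ∑ ω₁, if c₁ ω₁ == a then w₁ ω₁ * blk w₂ c₂ b (fun ω₂ => V (ω₁, ω₂)) else 0 := by
  unfold secU blk
  rw [Fintype.sum_prod_type]
  refine Finset.sum_congr rfl fun ω₁ _ => ?_
  rw [Finset.sum_congr rfl fun ω₂ _ => pt_sec' (c₁ ω₁ == a) (c₂ ω₂ == b) (V (ω₁, ω₂)) (w₁ ω₁) (w₂ ω₂)]
  cases c₁ ω₁ == a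
  · simp
  · simp only [if_true, Finset.mul_sum]

omit [PartialOrder R] [IsOrderedRing R] in
/-- On the trivial up-set the section block factorises: `U a b ⊤ = blk₁ a ⊤ · blk₂ b ⊤`. [this work] -/
theorem secU_top (a b : Bool) :
    secU w₁ c₁ w₂ c₂ a b top = blk w₁ c₁ a top * blk w₂ c₂ b top := by
  rw [secU_eq_sum_right]
  show (∑ ω₂, if c₂ ω₂ == b then w₂ ω₂ * blk w₁ c₁ a top else 0) = blk w₁ c₁ a top * blk w₂ c₂ b top
  generalize blk w₁ c₁ a top = B
  unfold blk
  rw [Finset.mul_sum]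
  refine Finset.sum_congr rfl fun ω₂ _ => ?_
  cases c₂ ω₂ == b <;> simp [top, mul_comm]

end Twist

section TwistIneq

variable {Ω₁ Ω₂ : Type*} [Fintype Ω₁] [Fintype Ω₂] [Preorder Ω₁] [Preorder Ω₂]
variable (w₁ : Ω₁ → R) (c₁ : Ω₁ → Bool) (w₂ : Ω₂ → R) (c₂ : Ω₂ → Bool) (τ : Bool → Bool → R)

/-- SIDE-1 SECTION INEQUALITY `P₁·U(false,b)(V) ≤ Q₁·U(true,b)(V)`: the hypothesis on side 1 applied to every section
`V(·, ω₂)` with `c₂ ω₂ = b`, summed with the nonnegative weights `w₂`. [this work] -/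
theorem sec_ineq_left (h₁ : GoodSide w₁ c₁) (hw₂ : ∀ ω₂, 0 ≤ w₂ ω₂) (b : Bool) {V : Ω₁ × Ω₂ → Bool}
    (hV : Monotone V) :
    blk w₁ c₁ true top * secU w₁ c₁ w₂ c₂ false b V ≤ blk w₁ c₁ false top * secU w₁ c₁ w₂ c₂ true b V := by
  rw [secU_eq_sum_right, secU_eq_sum_right, Finset.mul_sum, Finset.mul_sum]
  refine Finset.sum_le_sum fun ω₂ _ => ?_
  cases c₂ ω₂ == b
  · simp
  · simp only [if_true]
    have h := h₁.le _ (monotone_section_left hV ω₂)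
    calc blk w₁ c₁ true top * (w₂ ω₂ * blk w₁ c₁ false fun ω₁ => V (ω₁, ω₂))
        = w₂ ω₂ * (blk w₁ c₁ true top * blk w₁ c₁ false fun ω₁ => V (ω₁, ω₂)) := by ring
      _ ≤ w₂ ω₂ * ((blk w₁ c₁ true fun ω₁ => V (ω₁, ω₂)) * blk w₁ c₁ false top) :=
          mul_le_mul_of_nonneg_left h (hw₂ ω₂)
      _ = blk w₁ c₁ false top * (w₂ ω₂ * blk w₁ c₁ true fun ω₁ => V (ω₁, ω₂)) := by ring

/-- SIDE-2 SECTION INEQUALITY `P₂·U(a,false)(V) ≤ Q₂·U(a,true)(V)` (sections `V(ω₁, ·)`). [this work] -/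
theorem sec_ineq_right (h₂ : GoodSide w₂ c₂) (hw₁ : ∀ ω₁, 0 ≤ w₁ ω₁) (a : Bool) {V : Ω₁ × Ω₂ → Bool}
    (hV : Monotone V) :
    blk w₂ c₂ true top * secU w₁ c₁ w₂ c₂ a false V ≤ blk w₂ c₂ false top * secU w₁ c₁ w₂ c₂ a true V := by
  rw [secU_eq_sum_left, secU_eq_sum_left, Finset.mul_sum, Finset.mul_sum]
  refine Finset.sum_le_sum fun ω₁ _ => ?_
  cases c₁ ω₁ == a
  · simp
  · simp only [if_true]
    have h := h₂.le _ (monotone_section_right hV ω₁)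
    calc blk w₂ c₂ true top * (w₁ ω₁ * blk w₂ c₂ false fun ω₂ => V (ω₁, ω₂))
        = w₁ ω₁ * (blk w₂ c₂ true top * blk w₂ c₂ false fun ω₂ => V (ω₁, ω₂)) := by ring
      _ ≤ w₁ ω₁ * ((blk w₂ c₂ true fun ω₂ => V (ω₁, ω₂)) * blk w₂ c₂ false top) :=
          mul_le_mul_of_nonneg_left h (hw₁ ω₁)
      _ = blk w₂ c₂ false top * (w₁ ω₁ * blk w₂ c₂ true fun ω₂ => V (ω₁, ω₂)) := by ring

/-- THE TWISTED-PRODUCT LEMMA, `∨` form (parallel composition): if both sides are good and the twist is nonnegative,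
the glued side `(Ω₁ × Ω₂, w₁w₂τ(c₁,c₂), c₁ ∨ c₂)` is good.  Memo §1(c): three-term identity + section inequalities.
[this work] -/
theorem goodSide_twist_or (hτ : ∀ a b, 0 ≤ τ a b) (h₁ : GoodSide w₁ c₁) (h₂ : GoodSide w₂ c₂) :
    GoodSide (twistW w₁ c₁ w₂ c₂ τ) (orC c₁ c₂) := by
  refine ⟨fun ω => mul_nonneg (mul_nonneg (h₁.nonneg _) (h₂.nonneg _)) (hτ _ _), fun V hV => ?_⟩
  simp only [blk_or_true, blk_or_false, secU_top]
  rw [← sub_nonneg]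
  have key :
      (τ true true * secU w₁ c₁ w₂ c₂ true true V + τ true false * secU w₁ c₁ w₂ c₂ true false V
            + τ false true * secU w₁ c₁ w₂ c₂ false true V)
          * (τ false false * (blk w₁ c₁ false top * blk w₂ c₂ false top))
        - (τ true true * (blk w₁ c₁ true top * blk w₂ c₂ true top)
            + τ true false * (blk w₁ c₁ true top * blk w₂ c₂ false top)
            + τ false true * (blk w₁ c₁ false top * blk w₂ c₂ true top))
          * (τ false false * secU w₁ c₁ w₂ c₂ false false V)
      = τ false false *
          (τ true true *
              (blk w₂ c₂ false top
                  * (blk w₁ c₁ false top * secU w₁ c₁ w₂ c₂ true true V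
                      - blk w₁ c₁ true top * secU w₁ c₁ w₂ c₂ false true V)
                + blk w₁ c₁ true top
                  * (blk w₂ c₂ false top * secU w₁ c₁ w₂ c₂ false true V
                      - blk w₂ c₂ true top * secU w₁ c₁ w₂ c₂ false false V))
            + τ true false
              * (blk w₂ c₂ false top
                  * (blk w₁ c₁ false top * secU w₁ c₁ w₂ c₂ true false V
                      - blk w₁ c₁ true top * secU w₁ c₁ w₂ c₂ false false V))
            + τ false true
              * (blk w₁ c₁ false top
                  * (blk w₂ c₂ false top * secU w₁ c₁ w₂ c₂ false true V
                      - blk w₂ c₂ true top * secU w₁ c₁ w₂ c₂ false false V))) := by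
    ring
  rw [key]
  have hw₁ := h₁.nonneg
  have hw₂ := h₂.nonneg
  have G1t := sub_nonneg.mpr (sec_ineq_left w₁ c₁ w₂ c₂ h₁ hw₂ true hV)
  have G1f := sub_nonneg.mpr (sec_ineq_left w₁ c₁ w₂ c₂ h₁ hw₂ false hV)
  have G2f := sub_nonneg.mpr (sec_ineq_right w₁ c₁ w₂ c₂ h₂ hw₁ false hV)
  have P1 := blk_nonneg w₁ c₁ true top hw₁
  have Q1 := blk_nonneg w₁ c₁ false top hw₁
  have Q2 := blk_nonneg w₂ c₂ false top hw₂
  refine mul_nonneg (hτ _ _) (add_nonneg (add_nonneg ?_ ?_) ?_)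
  · exact mul_nonneg (hτ _ _) (add_nonneg (mul_nonneg Q2 G1t) (mul_nonneg P1 G2f))
  · exact mul_nonneg (hτ _ _) (mul_nonneg Q2 G1f)
  · exact mul_nonneg (hτ _ _) (mul_nonneg Q1 G2f)

/-- THE TWISTED-PRODUCT LEMMA, `∧` form (series composition, 1-sums, disjoint unions): if both sides are good and the
twist is nonnegative, the glued side `(Ω₁ × Ω₂, w₁w₂τ(c₁,c₂), c₁ ∧ c₂)` is good. [this work] -/
theorem goodSide_twist_and (hτ : ∀ a b, 0 ≤ τ a b) (h₁ : GoodSide w₁ c₁) (h₂ : GoodSide w₂ c₂) :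
    GoodSide (twistW w₁ c₁ w₂ c₂ τ) (andC c₁ c₂) := by
  refine ⟨fun ω => mul_nonneg (mul_nonneg (h₁.nonneg _) (h₂.nonneg _)) (hτ _ _), fun V hV => ?_⟩
  simp only [blk_and_true, blk_and_false, secU_top]
  rw [← sub_nonneg]
  have key :
      τ true true * secU w₁ c₁ w₂ c₂ true true V
          * (τ true false * (blk w₁ c₁ true top * blk w₂ c₂ false top)
              + τ false true * (blk w₁ c₁ false top * blk w₂ c₂ true top)
              + τ false false * (blk w₁ c₁ false top * blk w₂ c₂ false top))
        - τ true true * (blk w₁ c₁ true top * blk w₂ c₂ true top)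
          * (τ true false * secU w₁ c₁ w₂ c₂ true false V + τ false true * secU w₁ c₁ w₂ c₂ false true V
              + τ false false * secU w₁ c₁ w₂ c₂ false false V)
      = τ true true *
          (τ true false
              * (blk w₁ c₁ true top
                  * (blk w₂ c₂ false top * secU w₁ c₁ w₂ c₂ true true V
                      - blk w₂ c₂ true top * secU w₁ c₁ w₂ c₂ true false V))
            + τ false true
              * (blk w₂ c₂ true top
                  * (blk w₁ c₁ false top * secU w₁ c₁ w₂ c₂ true true V
                      - blk w₁ c₁ true top * secU w₁ c₁ w₂ c₂ false true V))
            + τ false false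
              * (blk w₂ c₂ false top
                  * (blk w₁ c₁ false top * secU w₁ c₁ w₂ c₂ true true V
                      - blk w₁ c₁ true top * secU w₁ c₁ w₂ c₂ false true V)
                + blk w₁ c₁ true top
                  * (blk w₂ c₂ false top * secU w₁ c₁ w₂ c₂ false true V
                      - blk w₂ c₂ true top * secU w₁ c₁ w₂ c₂ false false V))) := by
    ring
  rw [key]
  have hw₁ := h₁.nonneg
  have hw₂ := h₂.nonneg
  have G1t := sub_nonneg.mpr (sec_ineq_left w₁ c₁ w₂ c₂ h₁ hw₂ true hV)
  have G2t := sub_nonneg.mpr (sec_ineq_right w₁ c₁ w₂ c₂ h₂ hw₁ true hV)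
  have G2f := sub_nonneg.mpr (sec_ineq_right w₁ c₁ w₂ c₂ h₂ hw₁ false hV)
  have P1 := blk_nonneg w₁ c₁ true top hw₁
  have P2 := blk_nonneg w₂ c₂ true top hw₂
  have Q2 := blk_nonneg w₂ c₂ false top hw₂
  refine mul_nonneg (hτ _ _) (add_nonneg (add_nonneg ?_ ?_) ?_)
  · exact mul_nonneg (hτ _ _) (mul_nonneg P1 G2t)
  · exact mul_nonneg (hτ _ _) (mul_nonneg P2 G1t)
  · exact mul_nonneg (hτ _ _) (add_nonneg (mul_nonneg Q2 G1t) (mul_nonneg P1 G2f))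

end TwistIneq

end TwoCopyTwistedProduct

end Summit.CriticalPhenomena.PercolationContinuityZ3.Theorems
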